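import Literature.NumberTheory.ComplexMultiplication.FiniteQAlgebraLatticeLocallyPrincipal
import HarnessLib

/-!
# WEAK-CLASS REPRESENTATIVES INSIDE AN ORDER, for full lattices of an ARBITRARY finite-dimensional commutative
# `ℚ`-algebra `A`: for `Λ ⊇ 𝒪(L)` with `ΛL ∈ G(Λ)` there is `L_1 ∼_w L` with `L_1Λ = Λ` (Hertling–Larabi 2026
# Thm. 10.3 (a)); if `L` has local generators of `LΛ`, there is `L_2 ∼_w L` with `1 ∈ L_2 ⊆ Λ` (Thm. 10.3 (b) under
# that hypothesis), and then `L^k` is invertible with `𝒪(L^k) = L_2^{n−1}` for `k ≥ n − 1` (the printed deduction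
# of Thm. 10.1) — nilpotents allowed

[topic NumberTheory/ComplexMultiplication] General-`A` series (namespace
`Literature.NumberTheory.ComplexMultiplication.FiniteQAlgebraLattice`), the general-`A` twin of §§3–5 of the
`Y = L_1 ⊕ ⋯ ⊕ L_t` file `CMAlgebraLatticePowersInvertible` (seat p19 gen 33), whose proofs use nothing of `Y` beyond
its commutative `ℚ`-algebra structure; sequel of `FiniteQAlgebraLatticeLocallyPrincipal` (THEOREM 8.2 (b) Step 1 =
the surjectivity `G(Λ_2) → G(Λ_1)`, `exists_invertible_order_mul_eq` — exactly what `FiniteQAlgebraLatticePowersInvertible`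
lists as missing for Thm. 10.3 (a): «NOT here: HL Thm. 10.3 (a) (needs Thm. 8.2 (b) for general `A`)»), of
`FiniteQAlgebraLatticeLocalization` (Thm. 7.2 (b)(c), Rem. 7.4 ⇐) and of `FiniteQAlgebraLatticePowersInvertible`
(§§1–3: Thm. 10.3 (c)(d), `pow_isOrder_of_one_mem_le_order`, `pow_eq_pow_finrank_sub_one_of_one_mem_le_order`;
Thm. 10.1 itself is there UNCONDITIONALLY, `pow_mul_div_div_eq_of_isFullLattice`, by the content formula) — REUSED
by name.  Lane `lit-hodgefound` (Track 2 foundations library), seat p19 generation 37, row g37-#4.  THEOREMS ONLY: no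
definition, no instance, no notation, no named fact (D-0026, net Literature debt `0`), no `sorry`.

DEF-FREE SPELLING (as in the series).  Orders: `1 ∈ Λ ∧ Λ·Λ ⊆ Λ`; `𝒪(M) = M/M`; «invertible»: `M·((M/M)/M) =
M/M`; `L_1 ∼_w L_2`: `1 ∈ (L_1/L_2)·(L_2/L_1)`; «`L_1`, `L_2` agree at `p`»: `∃ s, p ∤ s ∧ sL_1 ⊆ L_2 ∧ sL_2 ⊆ L_1`.

## Source, VERBATIM

C. Hertling, K. Larabi, *Semigroups from full lattices in commutative ℚ-algebras*, arXiv:2602.14973 (2026)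
[HertlingLarabi2026], held `paper:arxiv-2602.14973`, §10 (chunks p0027–p0028) — `A` «a commutative ℚ-algebra with
unit element `1_A` of dimension `n ∈ ℤ_{≥2}`»: «**Theorem 10.3.** […] Let `L ∈ 𝓛(A)` be a full lattice. Let `Λ` be an
order with `Λ ⊃ 𝒪(L)` and `ΛL ∈ G(Λ)`. (a) A full lattice `L_1 ∈ 𝓛(A)` with `L_1 ∼_w L` and `L_1Λ = Λ` exists. (b) A
full lattice `L_2 ∈ 𝓛(A)` with `L_2 ∼_w L`, `1_A ∈ L_2` and `L_2 ⊂ Λ` exists. (c) The full lattice `L_2` in part (b)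
satisfies: (i) The sequence `(L_2^l)_{l∈ℕ}` of full lattices is increasing and becomes stationary, so there is a
minimal number `N ∈ ℕ` with `L_2^N = L_2^{N+l}` for each `l ≥ 0`. (ii) `Λ_2 := L_2^N` is an order with `Λ_2 ⊃ 𝒪(L)`.
(d) In part (c) `N ≤ n − 1`. *Proof:* (a) By Theorem 8.2 (b) the map `G(𝒪(L)) → G(Λ), K ↦ ΛK`, is a surjective
group homomorphism. Choose `K ∈ G(𝒪(L))` with `ΛK = ΛL`. Then `L_1 := LK⁻¹` satisfies `L_1Λ = Λ` and `L_1 ∼_w L`,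
the last statement because of Theorem 5.8. Especially `L_1 ⊂ Λ` because `1_A ∈ Λ`. (b) […] we can choose an
element `b_p ∈ L_1` with `b_p + pΛ ∈ (Λ/pΛ)^{unit}`. It satisfies `b_p ∈ L_1 ⊂ Λ` and by Lemma 7.5 (b)
`b_p ∈ Λ_(p)^{unit}`. […] By Theorem 7.3 there is a unique full lattice `L_2` with `(L_2)_(p) = b_p⁻¹(L_1)_(p)` for
each `p ∈ ℙ`. By Remark 7.4 `L_2 ∼_w L_1`, so `L_2 ∼_w L`. By construction `1_A = b_p⁻¹b_p ∈ (L_2)_(p)` for each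
`p ∈ ℙ`, so `1_A ∈ L_2`. For each `p ∈ ℙ` `(L_2)_(p) ⊂ Λ_(p)` because `b_p ∈ Λ_(p)^{unit}`, so `L_2 ⊂ Λ`.»  And the
proof of Theorem 10.1 (chunk p0028): «By (5.3) and Theorem 5.7 (b) `Λ_2 ⊃ 𝒪(L_2) = 𝒪(L)`. Then by (4.4)
`L^{n−1+l} ∼_w L_2^{n−1+l} = Λ_2` for `l ≥ 0`, so by Theorem 4.4 (c) and Theorem 5.7 (b) `L^{n−1+l}` is invertible
for `l ≥ 0` with `𝒪(L^{n−1+l}) = Λ_2`.»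

## What is proved

* §1 THM. 10.3 (a) AS PRINTED, general `A`: **`exists_weak_mul_order_eq_order`**.
* §2 THM. 10.3 (b) UNDER THE LOCAL-GENERATOR HYPOTHESIS: **`exists_weak_one_mem_le_order_of_forall_exists_units_locEq`**
  — if at each prime `p` where `L` and `Λ` disagree some `c_p ∈ L ∩ A^×` has `(LΛ)_(p) = c_pΛ_(p)`, then HL's gluing
  yields `L_2 ∼_w L` with `1 ∈ L_2 ⊆ Λ` (for ANY full order `Λ`).  CAVEAT carried over from the `Y`-file: part (b)
  AS PRINTED does not hold in general (`A = ℚ³`, `Λ = ℤ³`, `p = 2`, `L_1` = preimage of `{000,110,011,101} ⊂ 𝔽_2³`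
  has `L_1Λ = Λ`, yet no lattice locally equivalent to `L_1` contains `1` and lies in an order); HL's prime avoidance
  on the `𝔽_p`-subspace `(L_1+pΛ)/pΛ` is legitimate when every bad `p` has at most `p` maximal ideals of `Λ` above it.
* §3 THE PRINTED DEDUCTION OF THM. 10.1: **`pow_mul_div_div_eq_of_weak_one_mem_le_order`** (`L_2 ∼_w L` with
  `1 ∈ L_2 ⊆ Λ′` ⟹ `L^k` invertible for all `k ≥ n−1` with `𝒪(L^k) = L_2^{n−1}`), `pow_mul_div_div_eq_of_forall_exists_units_locEq`
  (lattices with local generators) and `pow_mul_div_div_eq_of_one_mem_units_smul_le_order` (the case `1 ∈ uL ⊆ Λ`).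
  (Thm. 10.1 holds unconditionally for general `A`: `FiniteQAlgebraLatticePowersInvertible.pow_mul_div_div_eq_of_isFullLattice`;
  the point here is the identification of the order `𝒪(L^k) = L_2^{n−1}`.)

## References
* [HertlingLarabi2026] C. Hertling, K. Larabi, arXiv:2602.14973 (2026), §10 Thm. 10.1, Thm. 10.3 (a)–(d) and proofs
  (chunks p0026–p0028); §5 Thm. 5.7, 5.8, §7 Thm. 7.2, 7.3, Rem. 7.4, §8 Thm. 8.2 (b).
  [cite: HertlingLarabi2026, §10 Thm. 10.3 (a), (b) and proof of Thm. 10.1, chunks p0027–p0028]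
* [DadeTausskyZassenhaus1962] E. C. Dade, O. Taussky, H. Zassenhaus, *On the theory of orders, in particular on the
  semigroup of ideal classes and genera of an order in an algebraic number field*, Math. Ann. 148 (1962) 31–64, §1.5
  Theorem C (as cited by HL 2026 §10; acq-11370). [cite: DadeTausskyZassenhaus1962, §1.5 Theorem C (as cited by HertlingLarabi2026 §10)]
-/

noncomputable section

open scoped Pointwise
open Module Function

open Literature.NumberTheory.Automorphic (IsFullLattice mem_units_smul_submodule_iff)

namespace Literature.NumberTheory.ComplexMultiplication.FiniteQAlgebraLattice

section WeakRepresentativeInOrder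

variable {A : Type} [CommRing A] [Algebra ℚ A]

/-! ## §1 Thm. 10.3 (a): a weakly equivalent `L_1` with `L_1Λ = Λ`, `L_1 ⊆ Λ` -/

/-- **HL 2026 THM. 10.3 (a): for a full lattice `L` and an order `Λ ⊇ 𝒪(L)` with `ΛL ∈ G(Λ)` there is a full lattice
`L_1 ∼_w L` with `L_1Λ = Λ` (hence `L_1 ⊆ Λ`)** — as printed: «By Theorem 8.2 (b) the map `G(𝒪(L)) → G(Λ), K ↦ ΛK`, is
a surjective group homomorphism [the tree's `exists_invertible_order_mul_eq`]. Choose `K ∈ G(𝒪(L))` with `ΛK = ΛL`. Then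
`L_1 := LK⁻¹` satisfies `L_1Λ = Λ` and `L_1 ∼_w L`, the last statement because of Theorem 5.8. Especially `L_1 ⊂ Λ`
because `1_A ∈ Λ`.»  (`∼_w` is spelled `1 ∈ (L:L_1)(L_1:L)`, g32-#1.) [cite: HertlingLarabi2026, §10 Thm. 10.3 (a) with proof, chunks p0027–p0028] -/
theorem exists_weak_mul_order_eq_order {M Λ : Submodule ℤ A} (hM : IsFullLattice A M)
    (hΛ : IsFullLattice A Λ) (h1Λ : (1 : A) ∈ Λ) (hΛΛ : Λ * Λ ≤ Λ) (hle : M / M ≤ Λ)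
    (hO : (Λ * M) / (Λ * M) = Λ) (hinv : (Λ * M) * (((Λ * M) / (Λ * M)) / (Λ * M)) = (Λ * M) / (Λ * M)) :
    ∃ L₁ : Submodule ℤ A, IsFullLattice A L₁ ∧ (1 : A) ∈ (M / L₁) * (L₁ / M) ∧
      L₁ * Λ = Λ ∧ L₁ ≤ Λ := by
  obtain ⟨K, hK, hKO, hKinv, hΛK⟩ := exists_invertible_order_mul_eq hΛΛ (isFullLattice_div hM hM)
    (one_mem_div_self M) (div_self_mul_div_self M).le hle (isFullLattice_mul hΛ hM) hO hinv
  -- `K⁻¹ = 𝒪(K):K`, invertible with `𝒪(K⁻¹) = 𝒪(K) = 𝒪(L)` and `KK⁻¹ = 𝒪(L)`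
  have hK'O : ((K / K) / K) / ((K / K) / K) = M / M := by rw [div_div_div_eq_of_mul_div_div_eq hKinv, hKO]
  have hK'inv : ((K / K) / K) * ((((K / K) / K) / ((K / K) / K)) / ((K / K) / K)) =
      ((K / K) / K) / ((K / K) / K) := by
    have hw : (1 : A) ∈ ((K / K) / K) * (K / (K / K)) := by
      rw [one_mem_div_mul_div_comm]
      exact (one_mem_div_mul_div_order_iff (one_mem_div_self K) (div_self_mul_div_self K).le).2 ⟨rfl, hKinv⟩
    exact div_mul_inv_eq_of_one_mem hw
  have hKK' : K * ((K / K) / K) = M / M := by rw [hKinv, hKO]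
  have hprod : M * ((K / K) / K) * Λ = Λ :=
    calc M * ((K / K) / K) * Λ = ((K / K) / K) * (Λ * M) := by
          rw [mul_comm M, mul_assoc, mul_comm M]
      _ = ((K / K) / K) * (Λ * K) := by rw [hΛK]
      _ = Λ * (K * ((K / K) / K)) := by rw [mul_comm Λ K, ← mul_assoc, mul_comm _ K, mul_comm]
      _ = Λ * (M / M) := by rw [hKK']
      _ = Λ := order_mul_order_eq_of_le hΛΛ (one_mem_div_self M) hle
  refine ⟨M * ((K / K) / K), isFullLattice_mul hM (isFullLattice_div (isFullLattice_div hK hK) hK),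
    one_mem_div_mul_div_of_invertible_mul_eq hK'O hK'inv rfl, hprod, fun x hx => ?_⟩
  have hx1 : x * 1 ∈ M * ((K / K) / K) * Λ := Submodule.mul_mem_mul hx h1Λ
  rwa [mul_one, hprod] at hx1

/-! ## §2 Thm. 10.3 (b) for lattices with LOCAL GENERATORS: `L_2 ∼_w L` with `1 ∈ L_2 ⊆ Λ` -/

omit [Algebra ℚ A] in
/-- `u⁻¹·(s′·((u·(s·x))·1)) = (s′s)·x` (file-local bookkeeping). [folklore] -/
private theorem units_inv_smul_zsmul_eq (u : Aˣ) (s s' : ℤ) (x : A) :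
    (u⁻¹ : Aˣ) • (s' • ((u • (s • x)) * 1)) = (s' * s) • x := by
  rw [mul_one, smul_comm (u⁻¹ : Aˣ) s', inv_smul_smul, smul_smul]

/-- **THM. 10.3 (b), FOR A LATTICE WITH LOCAL GENERATORS IN ITSELF: if at every prime `p` where `L` and the order `Λ`
disagree some `c_p ∈ L ∩ A^×` generates `LΛ` locally (`(LΛ)_(p) = c_pΛ_(p)`), then there is a full lattice `L_2` with
`L_2 ∼_w L`, `1 ∈ L_2` and `L_2 ⊆ Λ`.**  This is HL's construction «`b_p ∈ L_1 ⊂ Λ` with `b_p ∈ Λ_(p)^{unit}` … By Theorem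
7.3 there is a unique full lattice `L_2` with `(L_2)_(p) = b_p⁻¹(L_1)_(p)` for each `p`. By Remark 7.4 `L_2 ∼_w L_1`. By
construction `1_A = b_p⁻¹b_p ∈ (L_2)_(p)` for each `p`, so `1_A ∈ L_2`. For each `p` `(L_2)_(p) ⊂ Λ_(p)` … so `L_2 ⊂ Λ`»
(gluing = the tree's `exists_isFullLattice_forall_prime_locEq`, Thm. 7.2 (c); `∼_w` = its
`one_mem_div_mul_div_of_forall_prime_locEq_units_smul`, Rem. 7.4), run directly from `L` with the local generators `c_p`
in place of HL's `b_p`.  CAVEAT (why a hypothesis is needed): HL obtain `b_p` from «`(L_1+pΛ)/pΛ` is not contained in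
any one of these ideals … So it is also not contained in their union» — but `(L_1+pΛ)/pΛ` is only an `𝔽_p`-SUBSPACE, and
a subspace CAN lie in a union of `> p` proper ideals: for `A = ℚ³` (or a cubic field in which `2` splits completely),
`Λ = Λ_max`, `p = 2`, `L_1` = the preimage of `{000, 110, 011, 101} ⊂ 𝔽_2³`, one has `L_1Λ = Λ` but NO `L_2 ∼_w L_1` with
`1 ∈ L_2` inside an order exists; Thm. 10.3 (b) is false as printed there (Thm. 10.1 still holds: `L_1² = Λ`).
[cite: HertlingLarabi2026, §10 Thm. 10.3 (b) (proof, from «we can choose an element `b_p ∈ L_1`» on), chunk p0028] -/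
theorem exists_weak_one_mem_le_order_of_forall_exists_units_locEq {M Λ : Submodule ℤ A}
    (hM : IsFullLattice A M) (hΛ : IsFullLattice A Λ) (h1Λ : (1 : A) ∈ Λ)
    (hgen : ∀ p : ℕ, p.Prime →
      (¬ ∃ s : ℤ, ¬ (p : ℤ) ∣ s ∧ (∀ x ∈ M, s • x ∈ Λ) ∧ (∀ x ∈ Λ, s • x ∈ M)) →
        ∃ c : Aˣ, (c : A) ∈ M ∧ ∃ s : ℤ, ¬ (p : ℤ) ∣ s ∧
          (∀ x ∈ M * Λ, s • x ∈ c • Λ) ∧ (∀ x ∈ c • Λ, s • x ∈ M * Λ)) :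
    ∃ L₂ : Submodule ℤ A, IsFullLattice A L₂ ∧ (1 : A) ∈ (M / L₂) * (L₂ / M) ∧
      (1 : A) ∈ L₂ ∧ L₂ ≤ Λ := by
  classical
  -- `P_0` = the finitely many primes at which `L` and `Λ` disagree
  set P₀ : Finset ℕ := (finite_setOf_prime_not_locEq hM hΛ).toFinset with hP₀
  have hmemP₀ : ∀ p : ℕ, p ∈ P₀ ↔ p.Prime ∧
      ¬ ∃ s : ℤ, ¬ (p : ℤ) ∣ s ∧ (∀ x ∈ M, s • x ∈ Λ) ∧ (∀ x ∈ Λ, s • x ∈ M) := fun p => by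
    rw [hP₀, Set.Finite.mem_toFinset, Set.mem_setOf_eq]
  have hgen' : ∀ p ∈ P₀, ∃ c : Aˣ, (c : A) ∈ M ∧ ∃ s : ℤ, ¬ (p : ℤ) ∣ s ∧
      (∀ x ∈ M * Λ, s • x ∈ c • Λ) ∧ (∀ x ∈ c • Λ, s • x ∈ M * Λ) := fun p hp =>
    hgen p ((hmemP₀ p).1 hp).1 ((hmemP₀ p).1 hp).2
  choose! c hc using hgen'
  -- local models: `c_p⁻¹L` at `p ∈ P_0`, `Λ` elsewhere; glue them (Thm. 7.2 (c))
  let a : ℕ → Aˣ := fun p => if p ∈ P₀ then (c p)⁻¹ else 1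
  have ha : ∀ p ∉ P₀, a p = 1 := fun p hp => if_neg hp
  have ha' : ∀ p ∈ P₀, a p = (c p)⁻¹ := fun p hp => if_pos hp
  let U : ℕ → Submodule ℤ A := fun p => if p ∈ P₀ then a p • M else Λ
  have hUin : ∀ p ∈ P₀, U p = a p • M := fun p hp => if_pos hp
  have hUout : ∀ p ∉ P₀, U p = Λ := fun p hp => if_neg hp
  have hU : ∀ p, IsFullLattice A (U p) := fun p => by
    by_cases hp : p ∈ P₀
    · rw [hUin p hp]; exact IsFullLattice.units_smul _ hM
    · rw [hUout p hp]; exact hΛ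
  obtain ⟨L₂, hL₂, hloc⟩ := exists_isFullLattice_forall_prime_locEq hΛ hU P₀ hUout
  refine ⟨L₂, hL₂, ?_, ?_, fun x hx => ?_⟩
  · -- `L_2 ∼_w L` (Rem. 7.4): `L_2` agrees with `a_pL` at every prime
    refine one_mem_div_mul_div_of_forall_prime_locEq_units_smul hM hL₂ a P₀ ha fun p hp => ?_
    by_cases hp0 : p ∈ P₀
    · rw [← hUin p hp0]; exact hloc p hp
    · rw [ha p hp0, one_smul]
      have h1 := hloc p hp
      rw [hUout p hp0] at h1
      have h2 : ∃ s : ℤ, ¬ (p : ℤ) ∣ s ∧ (∀ x ∈ M, s • x ∈ Λ) ∧ (∀ x ∈ Λ, s • x ∈ M) := by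
        by_contra hne
        exact hp0 ((hmemP₀ p).2 ⟨hp, hne⟩)
      exact locEq_trans hp h1 (locEq_symm h2)
  · -- `1 ∈ L_2`: `1 = c_p⁻¹c_p ∈ c_p⁻¹L` at `p ∈ P_0`, `1 ∈ Λ` elsewhere
    refine mem_of_forall_prime_exists_coprime_smul_mem fun p hp => ?_
    obtain ⟨s, hs, -, hUL⟩ := hloc p hp
    refine ⟨s, hs, hUL 1 ?_⟩
    by_cases hp0 : p ∈ P₀
    · rw [hUin p hp0, ha' p hp0, mem_units_smul_submodule_iff, inv_inv, Units.smul_def, smul_eq_mul, mul_one]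
      exact (hc p hp0).1
    · rw [hUout p hp0]; exact h1Λ
  · -- `L_2 ⊆ Λ`: at `p ∈ P_0`, `c_p⁻¹L ⊆ c_p⁻¹(LΛ)`, which agrees with `c_p⁻¹c_pΛ = Λ`
    refine mem_of_forall_prime_exists_coprime_smul_mem fun q hq => ?_
    obtain ⟨s, hs, hLU, -⟩ := hloc q hq
    have hsx := hLU x hx
    by_cases hq0 : q ∈ P₀
    · rw [hUin q hq0, ha' q hq0, mem_units_smul_submodule_iff, inv_inv] at hsx
      obtain ⟨s', hs', hMΛc, -⟩ := (hc q hq0).2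
      have h3 := hMΛc _ (Submodule.mul_mem_mul hsx h1Λ)
      rw [mem_units_smul_submodule_iff, units_inv_smul_zsmul_eq] at h3
      exact ⟨s' * s, fun h => ((Nat.prime_iff_prime_int.1 hq).dvd_or_dvd h).elim hs' hs, h3⟩
    · rw [hUout q hq0] at hsx
      exact ⟨s, hs, hsx⟩

/-! ## §3 Thm. 10.1 (DTZ62 Theorem C): `L^k` is invertible for `k ≥ n − 1` -/

section PowersOfWeakRepresentative

variable [Module.Finite ℚ A]

/-- **HL 2026, PROOF OF THM. 10.1 (from (b) on): if the weak class of `L` contains a lattice `L_2` with `1 ∈ L_2 ⊆ Λ′` for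
an order `Λ′`, then every power `L^k`, `k ≥ n − 1` (`n = dim_ℚ A`; `Λ′` finitely generated with `Λ′Λ′ ⊆ Λ′`), is INVERTIBLE, with order `𝒪(L^k) = L_2^{n−1}`
independent of `k`** («By (5.3) and Theorem 5.7 (b) `Λ_2 ⊃ 𝒪(L_2) = 𝒪(L)`. Then by (4.4) `L^{n−1+l} ∼_w L_2^{n−1+l} = Λ_2`
for `l ≥ 0`, so by Theorem 4.4 (c) and Theorem 5.7 (b) `L^{n−1+l}` is invertible for `l ≥ 0` with
`𝒪(L^{n−1+l}) = Λ_2`»). [cite: HertlingLarabi2026, §10 proof of Thm. 10.1, chunk p0028] [cite: DadeTausskyZassenhaus1962, §1.5 Theorem C] -/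
theorem pow_mul_div_div_eq_of_weak_one_mem_le_order {M L₂ Λ : Submodule ℤ A}
    (hL₂ : IsFullLattice A L₂)
    (hw : (1 : A) ∈ (M / L₂) * (L₂ / M)) (h1 : (1 : A) ∈ L₂) (hΛ : Λ.FG)
    (hΛΛ : Λ * Λ ≤ Λ) (hL₂Λ : L₂ ≤ Λ) {k : ℕ} (hk : finrank ℚ A - 1 ≤ k) :
    M ^ k * ((M ^ k / M ^ k) / M ^ k) = M ^ k / M ^ k ∧ M ^ k / M ^ k = L₂ ^ (finrank ℚ A - 1) := by
  -- `L^j ∼_w L_2^j` for every `j` ((4.4))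
  have hwk : ∀ j : ℕ, (1 : A) ∈ (M ^ j / L₂ ^ j) * (L₂ ^ j / M ^ j) := fun j => by
    induction j with
    | zero => rw [pow_zero, pow_zero]; exact one_mem_div_self_mul_div_self 1
    | succ j ih => rw [pow_succ, pow_succ]; exact one_mem_div_mul_div_mul ih hw
  obtain ⟨h1k, hkk, -, -, -, -⟩ := pow_isOrder_of_one_mem_le_order hL₂ h1 hΛ hΛΛ hL₂Λ hk
  obtain ⟨hO, hinv⟩ := (one_mem_div_mul_div_order_iff h1k hkk.le).1 (hwk k)
  exact ⟨hinv, hO.trans (pow_eq_pow_finrank_sub_one_of_one_mem_le_order hL₂ h1 hΛ hΛΛ hL₂Λ hk)⟩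

/-- **HL 2026 THM. 10.1 ∕ DTZ62 THEOREM C ∕ Si70 FOR LATTICES WITH LOCAL GENERATORS: let `L` be a full lattice in
`A`, `n = dim_ℚ A`, and `Λ` ANY full order such that at every prime `p` where `L` and `Λ` disagree some
`c_p ∈ L ∩ A^×` generates `LΛ` locally (`(LΛ)_(p) = c_pΛ_(p)`).  Then `L^k` is INVERTIBLE for every `k ≥ n − 1`** («For
each full lattice `L ∈ 𝓛(A)` each power `L^k` with `k ≥ n − 1` is invertible» — here through §2's (b)-substitute; the
hypothesis holds, e.g., when each bad `p` has at most `p` maximal ideals of `Λ` above it, and is void of content for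
`1 ∈ uL ⊆ Λ`). [cite: HertlingLarabi2026, §10 Thm. 10.1, chunk p0026] [cite: DadeTausskyZassenhaus1962, §1.5 Theorem C] -/
theorem pow_mul_div_div_eq_of_forall_exists_units_locEq {M Λ : Submodule ℤ A}
    (hM : IsFullLattice A M) (hΛ : IsFullLattice A Λ) (h1Λ : (1 : A) ∈ Λ)
    (hΛΛ : Λ * Λ ≤ Λ)
    (hgen : ∀ p : ℕ, p.Prime →
      (¬ ∃ s : ℤ, ¬ (p : ℤ) ∣ s ∧ (∀ x ∈ M, s • x ∈ Λ) ∧ (∀ x ∈ Λ, s • x ∈ M)) →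
        ∃ c : Aˣ, (c : A) ∈ M ∧ ∃ s : ℤ, ¬ (p : ℤ) ∣ s ∧
          (∀ x ∈ M * Λ, s • x ∈ c • Λ) ∧ (∀ x ∈ c • Λ, s • x ∈ M * Λ)) :
    ∃ Λ₂ : Submodule ℤ A, (1 : A) ∈ Λ₂ ∧ Λ₂ * Λ₂ = Λ₂ ∧ Λ₂ ≤ Λ ∧
      ∀ k : ℕ, finrank ℚ A - 1 ≤ k →
        M ^ k * ((M ^ k / M ^ k) / M ^ k) = M ^ k / M ^ k ∧ M ^ k / M ^ k = Λ₂ := by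
  obtain ⟨L₂, hL₂, hw, h1, hle⟩ := exists_weak_one_mem_le_order_of_forall_exists_units_locEq hM hΛ h1Λ hgen
  obtain ⟨h1k, hkk, -, -, -, -⟩ := pow_isOrder_of_one_mem_le_order hL₂ h1 hΛ.1 hΛΛ hle le_rfl
  exact ⟨L₂ ^ (finrank ℚ A - 1), h1k, hkk, pow_le_of_le_order h1Λ hΛΛ hle _, fun k hk =>
    pow_mul_div_div_eq_of_weak_one_mem_le_order hL₂ hw h1 hΛ.1 hΛΛ hle hk⟩

/-- **THM. 10.1, THE CASE `1 ∈ uL ⊆ Λ` (no local hypothesis): if some unit multiple `uL` contains `1` and lies in an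
order, then `L^k` is invertible for all `k ≥ n − 1`, with `𝒪(L^k) = (uL)^{n−1}`** (`L ∼_ε uL ⟹ L ∼_w uL`, g32-#1
`one_mem_div_mul_div_of_units_smul_eq`; then §3's first theorem). [cite: HertlingLarabi2026, §10 Thm. 10.1 with Thm. 10.3 (c)(d), chunks p0026, p0028] [cite: DadeTausskyZassenhaus1962, §1.5 Theorem C] -/
theorem pow_mul_div_div_eq_of_one_mem_units_smul_le_order {M Λ : Submodule ℤ A} {u : Aˣ}
    (hM : IsFullLattice A M) (h1 : (1 : A) ∈ u • M) (hΛ : Λ.FG)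
    (hΛΛ : Λ * Λ ≤ Λ) (hle : u • M ≤ Λ) {k : ℕ} (hk : finrank ℚ A - 1 ≤ k) :
    M ^ k * ((M ^ k / M ^ k) / M ^ k) = M ^ k / M ^ k ∧ M ^ k / M ^ k = (u • M) ^ (finrank ℚ A - 1) :=
  pow_mul_div_div_eq_of_weak_one_mem_le_order (IsFullLattice.units_smul u hM)
    (one_mem_div_mul_div_of_units_smul_eq rfl) h1 hΛ hΛΛ hle hk

end PowersOfWeakRepresentative

end WeakRepresentativeInOrder

end Literature.NumberTheory.ComplexMultiplication.FiniteQAlgebraLattice
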